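import Literature.RepresentationTheory.MoeglinVignerasWaldspurger1987.RankOneTorusTraceHolds
import HarnessLib

/-!
# The finite-level character of the rank `1 × 1` oscillator representation on Weil's big cell, EXPLICITLY

Topic `RepresentationTheory/MoeglinVignerasWaldspurger1987`; namespace
`Literature.RepresentationTheory.MoeglinVignerasWaldspurger1987`.  THEOREMS ONLY (no definition, no named fact, no
`sorry`).  The tree's TR `rankOne_torusTrace_ne_zero` proves `tr(ω_{s₁}(z₀) | Fix_K) ≠ 0` by producing its value
`c · Gv` behind an `∃` (`rankOne_torus_bigCell_package` + H2 `HeisenbergGroup.trace_restrict_fixed_eq_of_bigCell_family`);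
comparing the oscillator representations of TWO skew-hermitian lines (cell `hodgecm-mathlib`, h413 road, SOCKETS-H413
§3 S6 «G2a» = the `(U(1), U(1))` theta dichotomy by the CHARACTER ROUTE) needs the VALUE:
**`rankOne_torusTrace_eq_explicit`** — for `z₀² ≠ 1` there is an open subgroup `K₀` such that for every `u = z₀ k`,
`k ∈ K₀`, every open `K ≤ K₀` and the space `W` of `ω_{s₁}(K)`-fixed vectors,
`tr(ω_{s₁}(u) | W) = λ(u) · |β(u)|_v^{-1/2} · g_{ψ_v}(β(u)⁻¹(1 - a(u)))`, where `ζ_u = a(u) + b(u) δ` is the scalar of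
`u`, `β = d b τ⁻¹` (`𝕋_v = (τ)`), `g_{ψ_v} = weilGauss` (Weil's stable Gauss integral) and `λ(u)` is THE scalar with
`ω_{s₁}(u) = λ(u) · r(e ι_v(u) e⁻¹)` (`r = bigCellOp`, `e = gramProd 𝕋_v`; MVW II.1 uniqueness) — Howe's character
`|N_{E/F}(1 - ζ_u)|^{-1/2} · γ` at finite level, value included, uniformly on the coset.  Proof = the package's proof
(one constant `c₀ = λ(z₀k)|β(z₀k)|^{-1/2}` on the coset by the test vector `𝟙_{𝔭^{n₁}}`, one Gauss value) + H2
re-centred at every `u = z₀ k₁` (the family `k ↦ z₀ (k₁ k)` runs over the same coset).  HC_CM is NOT advanced by this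
file alone; it is proved only modulo the 7 printed citations until rung 0 of the ladder closes.

## References
* [Weil1964] A. Weil, Acta Math. 111 (1964): n° 13 (16) p. 160, Chap. II n° 27 p. 175.
* [Howe1973] R. Howe, On the character of Weil's representation, Trans. AMS 177 (1973) 287–298.
* [MoeglinVignerasWaldspurger1987] C. Mœglin, M.-F. Vignéras, J.-L. Waldspurger, LNM 1291 (1987), Chap. 2 II.1 (A), II.8.
* [Rangarao1993] R. Ranga Rao, Pacific J. Math. 157 (1993), Lemma 3.2, (3.8)–(3.9) p. 351.
-/

set_option autoImplicit false

noncomputable section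

open NumberField IsDedekindDomain Matrix MeasureTheory
open scoped Matrix MatrixGroups NNReal Topology
open Literature.RepresentationTheory Literature.RepresentationTheory.HeisenbergGroup
open Literature.NumberTheory.GelbartRogawski1991.UnitaryDualPair.LocalSplitting
open Literature.NumberTheory.Automorphic Literature.NumberTheory.Automorphic.UnitaryGroup
open Literature.NumberTheory.Automorphic.Liu2021
open Literature.NumberTheory.GaloisRepresentations.IsNonarchimedeanLocalField
open Literature.NumberTheory.Weil1964

namespace Literature.RepresentationTheory.MoeglinVignerasWaldspurger1987

section Explicit

variable (F : Type) [Field F] [NumberField F] (E : Type) [Field E] [NumberField E] [Algebra F E]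
  [Algebra.IsQuadraticExtension F E] (c : E ≃ₐ[F] E) (δ : E) (hcδ : c δ = -δ) (hδ : δ ≠ 0) (d : F)
  (hd : δ * δ = algebraMap F E d) (t : Matrix (Fin 1) (Fin 1) F) (ht : t.IsSymm) (htd : IsUnit t.det)
  (J₁ : Matrix (Fin 1) (Fin 1) E) (hJ₁ : J₁ = t.map (algebraMap F E)) (v : HeightOneSpectrum (𝓞 F))
  (hE : IsField (UnitaryGroup.LocalRing E v))
  (s₁ : localPi E c 1 J₁ v →* LocalMp F 1 t v)
  (hs₁ : ∀ g, MpPsi.proj _ (s₁ g) = iota F E c 1 hcδ hδ hd t ht hJ₁ v g)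
  (hsm₁ : Representation.IsSmooth ((MpPsi.toRep (localSchrodinger F 1 t v)).comp s₁))

include htd in
omit [NumberField E] [Algebra.IsQuadraticExtension F E] in
/-- `𝕋_v = (τ)` with `τ = t₀₀ ≠ 0` (`det t` is a unit). [folklore] -/
private theorem localGram_entry_ne_zero' : localGram F 1 t v 0 0 ≠ 0 := by
  have h := (UnitaryGroup.isUnit_det_map (algebraMap F (v.adicCompletion F)) htd).ne_zero
  rwa [Matrix.det_fin_one] at h

/-- any bound is below some `q^{-e}` (`e ≤ 0` large negative). [folklore] -/
private theorem exists_le_inv_residueFieldCard_zpow' {K : Type*} [Field K] [ValuativeRel K] [TopologicalSpace K]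
    [IsNonarchimedeanLocalField K] (C : ℝ≥0) : ∃ e : ℤ, C ≤ ((residueFieldCard K : ℝ≥0)⁻¹) ^ e := by
  have hq : (1 : ℝ≥0) < (residueFieldCard K : ℝ≥0) := by exact_mod_cast one_lt_residueFieldCard K
  obtain ⟨n, hn⟩ := pow_unbounded_of_one_lt C hq
  refine ⟨-(n : ℤ), ?_⟩
  rw [_root_.zpow_neg, zpow_natCast, inv_pow, inv_inv]
  exact hn.le

set_option maxHeartbeats 1600000 in -- MEASURED (800 k, 1600 k]: statement + 25-binder assembly time out at 800 k
include htd ht hJ₁ hE hs₁ hsm₁ in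
/-- **The finite-level character of `ω_{s₁}` on Weil's big cell, explicitly and uniformly on a coset** (budget: the
statement and the assembly are measured in (800 k, 1600 k] heartbeats).  For the rank
`1 × 1` oscillator representation `ω_{s₁}` of the compact torus `U(J₁)(F_v) = E_v¹` at a non-split place and `z₀` with
`z₀² ≠ 1`, there is an open subgroup `K₀` such that for every `k ∈ K₀` (write `u = z₀ k`, `ζ_u = a + b δ`,
`β = d b τ⁻¹`, `g' = e ι_v(u) e⁻¹` — an element of Weil's big cell, `B`-block invertible), every open subgroup `K ≤ K₀`,
the (finite-dimensional) space `W` of `ω_{s₁}(K)`-fixed vectors, and THE scalar `λ` with `ω_{s₁}(u) = λ · r(g')`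
(`r = bigCellOp`):  `tr(ω_{s₁}(u) | W) = λ · |β|_v^{-1/2} · g_{ψ_v}(β⁻¹ (1 - a))`  (`|β|_v^{-1/2} = (√‖β‖_v)⁻¹`,
`g_{ψ_v}` = `weilGauss` for the Haar measure `μ` carried by `r`).
[cite: Weil1964, n° 13 (16) p. 160, Chap. II n° 27 p. 175; MoeglinVignerasWaldspurger1987, Chap. 2 II.1 (A), II.8] -/
theorem rankOne_torusTrace_eq_explicit (z₀ : localPi E c 1 J₁ v) (hz₀ : z₀ * z₀ ≠ 1)
    [MeasurableSpace (v.adicCompletion F)] [BorelSpace (v.adicCompletion F)]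
    (μ : Measure (v.adicCompletion F)) [μ.IsAddHaarMeasure] (m : ℤ) (hm : (adeleAddCharAt F v).HasConductorExp m) :
    ∃ K₀ : Subgroup (localPi E c 1 J₁ v), IsOpen (K₀ : Set (localPi E c 1 J₁ v)) ∧
      ∀ k ∈ K₀, ∀ (a b : v.adicCompletion F),
        a = QuadraticCoordinates.re (quadraticLocalEquiv E v c hcδ hδ).toLinearEquiv.toAddEquiv
              (fun w : PlacesOver E v => (((z₀ * k : localPi E c 1 J₁ v) : LocalGLPi E 1 v) w).val 0 0) →
        b = QuadraticCoordinates.im (quadraticLocalEquiv E v c hcδ hδ).toLinearEquiv.toAddEquiv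
              (fun w : PlacesOver E v => (((z₀ * k : localPi E c 1 J₁ v) : LocalGLPi E 1 v) w).val 0 0) →
        (d : v.adicCompletion F) * b * (localGram F 1 t v 0 0)⁻¹ ≠ 0 ∧
        ∀ K : Subgroup (localPi E c 1 J₁ v), IsOpen (K : Set (localPi E c 1 J₁ v)) → K ≤ K₀ →
        ∀ (W : Submodule ℂ (SchwartzBruhat (Fin 1 → v.adicCompletion F))) [FiniteDimensional ℂ W],
          (∀ f, f ∈ W ↔ ∀ k' ∈ K, ((MpPsi.toRep (localSchrodinger F 1 t v)).comp s₁) k' f = f) →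
          ∀ (hW : ∀ w ∈ W, ((MpPsi.toRep (localSchrodinger F 1 t v)).comp s₁) (z₀ * k) w ∈ W) (lam : ℂ),
            (∀ f : SchwartzBruhat (Fin 1 → v.adicCompletion F),
              ((MpPsi.toRep (localSchrodinger F 1 t v)).comp s₁) (z₀ * k) f =
                lam • bigCellOp (isLocallyConstant_of_isContinuousNontrivial (isContinuousNontrivial_adeleAddCharAt F v))
                  μ (isContinuousNontrivial_adeleAddCharAt F v) hm
                  (symplecticConj (gramProd (localGram F 1 t v)
                      (UnitaryGroup.isUnit_det_map (algebraMap F (v.adicCompletion F)) htd))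
                    (polar_dotProductBilin_gramProd (localGram F 1 t v)
                      (UnitaryGroup.isUnit_det_map (algebraMap F (v.adicCompletion F)) htd))
                    (iota F E c 1 hcδ hδ hd t ht hJ₁ v (z₀ * k))) f) →
            LinearMap.trace ℂ W ((((MpPsi.toRep (localSchrodinger F 1 t v)).comp s₁) (z₀ * k)).restrict hW) =
              lam * ((Real.sqrt (normAbs (v.adicCompletion F)
                  ((d : v.adicCompletion F) * b * (localGram F 1 t v 0 0)⁻¹)) : ℝ) : ℂ)⁻¹ *
                weilGauss (adeleAddCharAt F v) μ (((d : v.adicCompletion F) * b * (localGram F 1 t v 0 0)⁻¹)⁻¹ * (1 - a)) := by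
  classical
  haveI : SecondCountableTopology (v.adicCompletion F) := secondCountableTopology_localField (v.adicCompletion F)
  -- ### notation and basic non-vanishing facts
  have hψ := isContinuousNontrivial_adeleAddCharAt F v
  have hq := isQuadraticCoordinates_local E v c hcδ hδ hd
  have hJ₁' : J₁ 0 0 ≠ 0 := by
    rw [hJ₁, Matrix.map_apply, map_ne_zero_iff _ (algebraMap F E).injective, ← Matrix.det_fin_one t]; exact htd.ne_zero
  have hτ0 : localGram F 1 t v 0 0 ≠ 0 := localGram_entry_ne_zero' F t htd v
  have hd0 : (d : v.adicCompletion F) ≠ 0 := by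
    intro h0
    have hδδ := hq.mul_self; rw [h0, map_zero] at hδδ
    letI := hE.toField
    have h1 := hq.im_delta; rw [mul_self_eq_zero.1 hδδ, map_zero] at h1
    exact zero_ne_one h1
  -- the coordinate functions of `z₀ k`
  obtain ⟨aOf, haOf⟩ : ∃ f : localPi E c 1 J₁ v → v.adicCompletion F, ∀ k, f k =
      QuadraticCoordinates.re (quadraticLocalEquiv E v c hcδ hδ).toLinearEquiv.toAddEquiv
        (fun w : PlacesOver E v => (((z₀ * k : localPi E c 1 J₁ v) : LocalGLPi E 1 v) w).val 0 0) := ⟨_, fun _ => rfl⟩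
  obtain ⟨bOf, hbOf⟩ : ∃ f : localPi E c 1 J₁ v → v.adicCompletion F, ∀ k, f k =
      QuadraticCoordinates.im (quadraticLocalEquiv E v c hcδ hδ).toLinearEquiv.toAddEquiv
        (fun w : PlacesOver E v => (((z₀ * k : localPi E c 1 J₁ v) : LocalGLPi E 1 v) w).val 0 0) := ⟨_, fun _ => rfl⟩
  have ha_cont : Continuous aOf := (funext haOf : aOf = _) ▸ (rankOne_continuous_coords E c hcδ hδ v z₀).1
  have hb_cont : Continuous bOf := (funext hbOf : bOf = _) ▸ (rankOne_continuous_coords E c hcδ hδ v z₀).2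
  -- `β k = d b(z₀k) τ⁻¹`, `A k = β_k⁻¹ (1 - a(z₀k))`
  obtain ⟨β, hβ⟩ : ∃ f : localPi E c 1 J₁ v → v.adicCompletion F, ∀ k, f k =
      (d : v.adicCompletion F) * bOf k * (localGram F 1 t v 0 0)⁻¹ := ⟨_, fun _ => rfl⟩
  obtain ⟨A, hA⟩ : ∃ f : localPi E c 1 J₁ v → v.adicCompletion F, ∀ k, f k = (β k)⁻¹ * (1 - aOf k) :=
    ⟨_, fun _ => rfl⟩
  -- at `k = 1`: `b₀ ≠ 0`, `a₀ ≠ 1`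
  have hb1 : bOf 1 ≠ 0 := by
    rw [hbOf 1, mul_one]; exact rankOne_im_ne_zero_of_mul_self_ne_one E c J₁ v hJ₁' hcδ hδ hd z₀ hz₀
  have hβ1 : β 1 ≠ 0 := by rw [hβ 1]; exact mul_ne_zero (mul_ne_zero hd0 hb1) (inv_ne_zero hτ0)
  have ha1 : 1 - aOf 1 ≠ 0 := by
    intro h
    have hsq := rankOne_re_sq_sub E c J₁ v hJ₁' hcδ hδ hd (z₀ * 1)
    rw [← haOf 1, ← hbOf 1, show aOf 1 = 1 from (sub_eq_zero.1 h).symm, one_pow, sub_eq_self, mul_eq_zero] at hsq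
    exact hsq.elim hd0 fun h0 => hb1 (pow_eq_zero_iff two_ne_zero |>.1 h0)
  have hA1 : A 1 ≠ 0 := by rw [hA 1]; exact mul_ne_zero (inv_ne_zero hβ1) ha1
  -- ### the Gauss constants
  obtain ⟨vA, hvA⟩ := exists_normAbs_eq_inv_zpow hA1
  obtain ⟨v₂, hv₂⟩ := exists_normAbs_eq_inv_zpow (two_ne_zero : (2 : v.adicCompletion F) ≠ 0)
  set m₀ : ℤ := min (m - vA - 2 * v₂) 0 with hm₀
  have hm₀' : 2 * m₀ ≤ m - vA - 2 * v₂ := by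
    rcases le_total (m - vA - 2 * v₂) 0 with h | h <;> [rw [hm₀, min_eq_left h]; rw [hm₀, min_eq_right h]] <;> omega
  -- ### the box-shift constant
  obtain ⟨C, hC⟩ : ∃ C : ℝ≥0, C = max (normAbs (v.adicCompletion F) (β 1)⁻¹) (normAbs (v.adicCompletion F) (A 1)) := ⟨_, rfl⟩
  obtain ⟨e, he⟩ := exists_le_inv_residueFieldCard_zpow' (K := v.adicCompletion F) C
  obtain ⟨n₁, hn₁'⟩ : ∃ n₁ : ℤ, m ≤ -v₂ + e + 2 * n₁ := ⟨max 0 (m + v₂ - e), by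
    rcases le_total 0 (m + v₂ - e) with h | h <;> [rw [max_eq_right h]; rw [max_eq_left h]] <;> omega⟩
  -- ### the neighbourhood of `1` and the open subgroup `K₀`
  have hcn := LocalFieldHaar.continuous_normAbs (F := v.adicCompletion F)
  have hA_cont : ContinuousAt A 1 := by
    have hβf : β = fun k => (d : v.adicCompletion F) * bOf k * (localGram F 1 t v 0 0)⁻¹ := funext hβ
    have hAf : A = fun k => (β k)⁻¹ * (1 - aOf k) := funext hA
    have h1 : ContinuousAt β 1 := by
      rw [hβf]; exact ((continuous_const.mul hb_cont).mul continuous_const).continuousAt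
    rw [hAf]
    exact (h1.inv₀ hβ1).mul (continuous_const.sub ha_cont).continuousAt
  have hO : (bOf ⁻¹' {y : v.adicCompletion F |
        normAbs (v.adicCompletion F) (y - bOf 1) < normAbs (v.adicCompletion F) (bOf 1)} ∩
      A ⁻¹' ({y : v.adicCompletion F | normAbs (v.adicCompletion F) (y - A 1) < normAbs (v.adicCompletion F) (A 1)} ∩
        (fun y : v.adicCompletion F => y - A 1) ⁻¹' primePowBall (v.adicCompletion F) (m - 2 * m₀)) ∩
      (Representation.stabilizerSubgroup ((MpPsi.toRep (localSchrodinger F 1 t v)).comp s₁)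
        (piBallSB (v.adicCompletion F) (Fin 1) n₁) : Set (localPi E c 1 J₁ v))) ∈
      𝓝 (1 : localPi E c 1 J₁ v) := by
    refine Filter.inter_mem (Filter.inter_mem ?_ (hA_cont.preimage_mem_nhds ?_)) ?_
    · refine ((isOpen_lt (hcn.comp (continuous_id.sub continuous_const)) continuous_const).preimage hb_cont).mem_nhds ?_
      show normAbs (v.adicCompletion F) (bOf 1 - bOf 1) < normAbs (v.adicCompletion F) (bOf 1)
      rw [sub_self, map_zero]; exact normAbs_units_pos (Units.mk0 _ hb1)
    · refine IsOpen.mem_nhds ?_ ⟨?_, ?_⟩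
      · exact (isOpen_lt (hcn.comp (continuous_id.sub continuous_const)) continuous_const).inter
          ((isOpen_primePowBall _).preimage (continuous_id.sub continuous_const))
      · show normAbs (v.adicCompletion F) (A 1 - A 1) < normAbs (v.adicCompletion F) (A 1)
        rw [sub_self, map_zero]; exact normAbs_units_pos (Units.mk0 _ hA1)
      · show A 1 - A 1 ∈ primePowBall (v.adicCompletion F) (m - 2 * m₀)
        rw [sub_self]; exact zero_mem_primePowBall _
    · refine (hsm₁ _).mem_nhds ?_
      rw [SetLike.mem_coe, Representation.mem_stabilizerSubgroup, map_one]; rfl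
  obtain ⟨K₀, hK₀o, hK₀O⟩ := rankOne_exists_openSubgroup_subset E c hcδ hδ t htd hJ₁ v hE hO
  -- facts valid on `K₀`
  have hK : ∀ k ∈ K₀, normAbs (v.adicCompletion F) (bOf k) = normAbs (v.adicCompletion F) (bOf 1) ∧
      (normAbs (v.adicCompletion F) (A k - A 1) < normAbs (v.adicCompletion F) (A 1) ∧
        A k - A 1 ∈ primePowBall (v.adicCompletion F) (m - 2 * m₀)) ∧
      ((MpPsi.toRep (localSchrodinger F 1 t v)).comp s₁) k (piBallSB (v.adicCompletion F) (Fin 1) n₁) =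
        piBallSB (v.adicCompletion F) (Fin 1) n₁ := by
    intro k hk
    obtain ⟨⟨h1, h2⟩, h3⟩ := hK₀O hk
    change normAbs (v.adicCompletion F) (bOf k - bOf 1) < normAbs (v.adicCompletion F) (bOf 1) at h1
    change normAbs (v.adicCompletion F) (A k - A 1) < normAbs (v.adicCompletion F) (A 1) ∧
      A k - A 1 ∈ primePowBall (v.adicCompletion F) (m - 2 * m₀) at h2
    refine ⟨?_, h2, h3⟩
    simpa only [add_sub_cancel] using LocalFieldHaar.normAbs_add_eq_of_lt h1
  have hbk : ∀ k ∈ K₀, bOf k ≠ 0 := fun k hk h0 => by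
    have := (hK k hk).1; rw [h0, map_zero] at this; exact (normAbs_units_pos (Units.mk0 _ hb1)).ne this
  have hβk : ∀ k ∈ K₀, β k ≠ 0 := fun k hk => by
    rw [hβ k]; exact mul_ne_zero (mul_ne_zero hd0 (hbk k hk)) (inv_ne_zero hτ0)
  have hβnorm : ∀ k ∈ K₀, normAbs (v.adicCompletion F) (β k)⁻¹ = normAbs (v.adicCompletion F) (β 1)⁻¹ := by
    intro k hk
    rw [hβ k, hβ 1, map_inv₀, map_inv₀, map_mul, map_mul, map_mul, map_mul, (hK k hk).1]
  have hAlt : ∀ k ∈ K₀, normAbs (v.adicCompletion F) (A 1 - A k) < normAbs (v.adicCompletion F) (A 1) := by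
    intro k hk; have h := (hK k hk).2.1.1; rwa [← normAbs_neg, neg_sub] at h
  have hAmem : ∀ k ∈ K₀, A 1 - A k ∈ primePowBall (v.adicCompletion F) (m - 2 * m₀) := by
    intro k hk; have h := neg_mem_primePowBall (hK k hk).2.1.2; rwa [neg_sub] at h
  have hAnorm : ∀ k ∈ K₀, normAbs (v.adicCompletion F) (A k) = normAbs (v.adicCompletion F) (A 1) :=
    fun k hk => Literature.NumberTheory.Weil1964.normAbs_eq_of_normAbs_sub_lt (hAlt k hk)
  have hsC : ∀ k ∈ K₀, normAbs (v.adicCompletion F) ((β k)⁻¹ * aOf k) ≤ C := by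
    intro k hk
    have e1 : (β k)⁻¹ * aOf k = (β k)⁻¹ + -A k := by rw [hA k]; ring
    rw [e1, hC]
    refine (normAbs_add_le_max _ _).trans ?_
    rw [normAbs_neg, hβnorm k hk, hAnorm k hk]
  have hβC : ∀ k ∈ K₀, normAbs (v.adicCompletion F) (β k)⁻¹ ≤ C := fun k hk => by rw [hβnorm k hk, hC]; exact le_max_left _ _
  have hq0 : (0 : ℝ≥0) < (residueFieldCard (v.adicCompletion F) : ℝ≥0)⁻¹ := inv_residueFieldCard_pos
  have hq1 : (residueFieldCard (v.adicCompletion F) : ℝ≥0)⁻¹ ≤ 1 := inv_residueFieldCard_lt_one.le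
  -- ### the big-cell data along `z₀ K₀`, chosen as functions of `k`, WITH the identification `word = r(g')`
  have key : ∀ k : localPi E c 1 J₁ v, ∃ (B : (Fin 1 → v.adicCompletion F) ≃ₗ[v.adicCompletion F]
      (Fin 1 → v.adicCompletion F)) (γ δ' : (Fin 1 → v.adicCompletion F) →ₗ[v.adicCompletion F]
      (Fin 1 → v.adicCompletion F)) (cst : ℂ), β k ≠ 0 →
      cst ≠ 0 ∧
      (∀ f : SchwartzBruhat (Fin 1 → v.adicCompletion F), ((MpPsi.toRep (localSchrodinger F 1 t v)).comp s₁) (z₀ * k) f =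
          cst • ((unipOpPi (isLocallyConstant_of_isContinuousNontrivial hψ) γ * leviOpPi B *
              fourierOpPi (ι := Fin 1) μ hψ hm * unipOpPi (isLocallyConstant_of_isContinuousNontrivial hψ) δ' :
            SchwartzBruhat (Fin 1 → v.adicCompletion F) ≃ₗ[ℂ] SchwartzBruhat (Fin 1 → v.adicCompletion F)) f)) ∧
      (∀ x : Fin 1 → v.adicCompletion F,
        B.symm x = (β k)⁻¹ • x ∧ γ x = (aOf k * (β k)⁻¹) • x ∧ δ' x = ((β k)⁻¹ * aOf k) • x) ∧
      (∀ x : Fin 1 → v.adicCompletion F,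
        x ⬝ᵥ B.symm x - halfForm γ x - halfForm δ' x = A k * x 0 ^ 2) ∧
      ((unipOpPi (isLocallyConstant_of_isContinuousNontrivial hψ) γ * leviOpPi B *
          fourierOpPi (ι := Fin 1) μ hψ hm * unipOpPi (isLocallyConstant_of_isContinuousNontrivial hψ) δ' :
            SchwartzBruhat (Fin 1 → v.adicCompletion F) ≃ₗ[ℂ] SchwartzBruhat (Fin 1 → v.adicCompletion F)) =
        bigCellOp (isLocallyConstant_of_isContinuousNontrivial hψ) μ hψ hm
          (symplecticConj (gramProd (localGram F 1 t v) (UnitaryGroup.isUnit_det_map (algebraMap F (v.adicCompletion F)) htd))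
            (polar_dotProductBilin_gramProd (localGram F 1 t v) (UnitaryGroup.isUnit_det_map (algebraMap F (v.adicCompletion F)) htd))
            (iota F E c 1 hcδ hδ hd t ht hJ₁ v (z₀ * k)))) ∧
      (LinearMap.det (B : (Fin 1 → v.adicCompletion F) →ₗ[v.adicCompletion F] (Fin 1 → v.adicCompletion F)) = β k) := by
    intro k
    by_cases hk : β k ≠ 0
    · have hk' : (d : v.adicCompletion F) * bOf k * (localGram F 1 t v 0 0)⁻¹ ≠ 0 := by rw [← hβ k]; exact hk
      have hk'' : (d : v.adicCompletion F) *
          QuadraticCoordinates.im (quadraticLocalEquiv E v c hcδ hδ).toLinearEquiv.toAddEquiv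
            (fun w : PlacesOver E v => (((z₀ * k : localPi E c 1 J₁ v) : LocalGLPi E 1 v) w).val 0 0) *
          (localGram F 1 t v 0 0)⁻¹ ≠ 0 := by rw [← hbOf k]; exact hk'
      have hB := rankOne_blockB_bijective E c hcδ hδ hd t ht htd hJ₁ v (z₀ * k) _ rfl hk''
      obtain ⟨lam, hlam⟩ := rankOne_exists_scalar_bigCellWord F E c hcδ hδ hd t ht htd hJ₁ v μ hm s₁ hs₁ (z₀ * k) _ rfl hB
      have hcells := fun x => rankOne_cells E c hcδ hδ hd t ht htd hJ₁ v (z₀ * k) _ rfl hk'' hB x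
      refine ⟨_, _, _, (lam : ℂ), fun _ => ⟨lam.ne_zero, hlam, fun x => ?_, fun x => ?_, ?_, ?_⟩⟩
      · rw [hβ k, hbOf k, haOf k]; exact hcells x
      · rw [hA k, hβ k, hbOf k, haOf k]; exact rankOne_word_phase E c hcδ hδ hd t ht htd hJ₁ v (z₀ * k) _ rfl hk'' hB x
      · rw [bigCellOp_of_bijective]
      · -- `det B = β`: `B` is the scalar `β` on `F_v^1`
        have hBx : ∀ x : Fin 1 → v.adicCompletion F,
            (cellB _ hB : (Fin 1 → v.adicCompletion F) ≃ₗ[v.adicCompletion F] (Fin 1 → v.adicCompletion F)) x =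
              β k • x := by
          intro x
          have h1 := (hcells (β k • x)).1
          rw [← hbOf k, ← hβ k, smul_smul, inv_mul_cancel₀ hk, one_smul] at h1
          have h2 := congrArg (cellB _ hB) h1
          rw [LinearEquiv.apply_symm_apply] at h2
          exact h2.symm
        have hBe : ((cellB _ hB : (Fin 1 → v.adicCompletion F) ≃ₗ[v.adicCompletion F] (Fin 1 → v.adicCompletion F)) :
            (Fin 1 → v.adicCompletion F) →ₗ[v.adicCompletion F] (Fin 1 → v.adicCompletion F)) =
            β k • LinearMap.id := by
          apply LinearMap.ext; intro x; rw [LinearEquiv.coe_coe, hBx, LinearMap.smul_apply, LinearMap.id_apply]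
        rw [hBe, LinearMap.det_smul, LinearMap.det_id, mul_one, Module.finrank_fintype_fun_eq_card, Fintype.card_fin,
          pow_one]
    · exact ⟨LinearEquiv.refl _ _, 0, 0, 0, fun h => absurd h hk⟩
  choose B_ γ_ δ_ cst hkey using key
  -- ### the constant, via the test vector `𝟙_{(𝔭^{n₁})^1}`
  have hword : ∀ k ∈ K₀, ∀ f : SchwartzBruhat (Fin 1 → v.adicCompletion F),
      ((MpPsi.toRep (localSchrodinger F 1 t v)).comp s₁) (z₀ * k) f =
      cst k • ((unipOpPi (isLocallyConstant_of_isContinuousNontrivial hψ) (γ_ k) * leviOpPi (B_ k) *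
          fourierOpPi (ι := Fin 1) μ hψ hm * unipOpPi (isLocallyConstant_of_isContinuousNontrivial hψ) (δ_ k) :
        SchwartzBruhat (Fin 1 → v.adicCompletion F) ≃ₗ[ℂ] SchwartzBruhat (Fin 1 → v.adicCompletion F)) f) :=
    fun k hk => ((hkey k) (hβk k hk)).2.1
  have hfix : ∀ k ∈ K₀, ((MpPsi.toRep (localSchrodinger F 1 t v)).comp s₁) k (piBallSB (v.adicCompletion F) (Fin 1) n₁) =
      piBallSB (v.adicCompletion F) (Fin 1) n₁ := fun k hk => (hK k hk).2.2
  have hδφ : ∀ k ∈ K₀, ∀ x ∈ piPrimePowBall (v.adicCompletion F) (Fin 1) n₁,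
      halfForm (δ_ k) x ∈ primePowBall (v.adicCompletion F) m := by
    intro k hk x hx
    rw [halfForm_apply, ((hkey k (hβk k hk)).2.2.1 x).2.2, dotProduct_smul, smul_eq_mul, invOf_eq_inv,
      mem_primePowBall_iff, map_mul, map_mul, map_inv₀, hv₂]
    have hx0 : normAbs (v.adicCompletion F) (x 0) ≤ (residueFieldCard (v.adicCompletion F) : ℝ≥0)⁻¹ ^ n₁ :=
      (mem_primePowBall_iff).1 ((mem_piPrimePowBall_iff).1 hx 0)
    have hxx : normAbs (v.adicCompletion F) (x ⬝ᵥ x) ≤ (residueFieldCard (v.adicCompletion F) : ℝ≥0)⁻¹ ^ (2 * n₁) := by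
      have e1 : x ⬝ᵥ x = x 0 * x 0 := by simp [dotProduct]
      rw [e1, map_mul, two_mul, zpow_add₀ hq0.ne']
      exact mul_le_mul' hx0 hx0
    calc ((residueFieldCard (v.adicCompletion F) : ℝ≥0)⁻¹ ^ v₂)⁻¹ *
          (normAbs (v.adicCompletion F) ((β k)⁻¹ * aOf k) * normAbs (v.adicCompletion F) (x ⬝ᵥ x))
        ≤ (residueFieldCard (v.adicCompletion F) : ℝ≥0)⁻¹ ^ (-v₂) *
          ((residueFieldCard (v.adicCompletion F) : ℝ≥0)⁻¹ ^ e *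
            (residueFieldCard (v.adicCompletion F) : ℝ≥0)⁻¹ ^ (2 * n₁)) := by
          rw [_root_.zpow_neg]
          exact mul_le_mul' le_rfl (mul_le_mul' ((hsC k hk).trans he) hxx)
      _ = (residueFieldCard (v.adicCompletion F) : ℝ≥0)⁻¹ ^ (-v₂ + e + 2 * n₁) := by
          rw [zpow_add₀ hq0.ne', zpow_add₀ hq0.ne', mul_assoc]
      _ ≤ (residueFieldCard (v.adicCompletion F) : ℝ≥0)⁻¹ ^ m := zpow_le_zpow_right_of_le_one₀ hq0 hq1 hn₁'
  have hscal := wordScalar_mul_inv_modSqrt_eq (isLocallyConstant_of_isContinuousNontrivial hψ) μ hψ hm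
    ((MpPsi.toRep (localSchrodinger F 1 t v)).comp s₁) K₀ z₀ γ_ δ_ B_ cst n₁ hword hfix hδφ
  set c₀ : ℂ := cst 1 * ((modSqrt (B_ 1) : ℂ))⁻¹ with hc₀def
  -- `c₀ = cst(k) |det B_k|^{-1/2}` for every `k ∈ K₀`, and the family with ONE constant
  have hc₀k : ∀ k ∈ K₀, c₀ = cst k * ((modSqrt (B_ k) : ℂ))⁻¹ := fun k hk => (hscal k hk).symm
  have hc₀ : ∀ k ∈ K₀, ∀ f : SchwartzBruhat (Fin 1 → v.adicCompletion F),
      ((MpPsi.toRep (localSchrodinger F 1 t v)).comp s₁) (z₀ * k) f =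
      (c₀ * (modSqrt (B_ k) : ℂ)) • ((unipOpPi (isLocallyConstant_of_isContinuousNontrivial hψ) (γ_ k) * leviOpPi (B_ k) *
          fourierOpPi (ι := Fin 1) μ hψ hm * unipOpPi (isLocallyConstant_of_isContinuousNontrivial hψ) (δ_ k) :
        SchwartzBruhat (Fin 1 → v.adicCompletion F) ≃ₗ[ℂ] SchwartzBruhat (Fin 1 → v.adicCompletion F)) f) := by
    intro k hk f
    have hB : (modSqrt (B_ k) : ℂ) ≠ 0 := Complex.ofReal_ne_zero.2 (modSqrt_pos (B_ k)).ne'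
    rw [hword k hk f, hc₀k k hk, inv_mul_cancel_right₀ hB]
  -- ### (W2)/(W3) along the coset
  have hW2 : ∀ k ∈ K₀, ∀ n ≤ m₀,
      ∫ x in primePowPiBox (v.adicCompletion F) (Fin 1) n,
        ((adeleAddCharAt F v (x ⬝ᵥ (B_ k).symm x - halfForm (γ_ k) x - halfForm (δ_ k) x) : Circle) : ℂ)
          ∂(Measure.pi fun _ : Fin 1 => μ) = weilGauss (adeleAddCharAt F v) μ (A 1) := by
    intro k hk n hn
    have hph := (hkey k (hβk k hk)).2.2.2.1
    calc ∫ x in primePowPiBox (v.adicCompletion F) (Fin 1) n,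
          ((adeleAddCharAt F v (x ⬝ᵥ (B_ k).symm x - halfForm (γ_ k) x - halfForm (δ_ k) x) : Circle) : ℂ)
            ∂(Measure.pi fun _ : Fin 1 => μ)
        = ∫ x in primePowPiBox (v.adicCompletion F) (Fin 1) n,
            ((adeleAddCharAt F v (A k * x 0 ^ 2) : Circle) : ℂ) ∂(Measure.pi fun _ : Fin 1 => μ) :=
          setIntegral_congr_fun (measurableSet_primePowPiBox n) fun x _ => by rw [hph x]
      _ = gaussBall (adeleAddCharAt F v) μ (A k) n := setIntegral_primePowPiBox_fin_one_psiSq μ _ _ n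
      _ = weilGauss (adeleAddCharAt F v) μ (A 1) :=
          Literature.NumberTheory.Weil1964.gaussBall_eq_weilGauss_of_sub_mem_of_lt μ hm hvA (hAlt k hk) hv₂ hm₀'
            (hAmem k hk) hn
  have hW3 : ∀ k ∈ K₀, ∀ (a : ℤ) (x : Fin 1 → v.adicCompletion F), x ∈ primePowPiBox (v.adicCompletion F) (Fin 1) a →
      γ_ k x ∈ primePowPiBox (v.adicCompletion F) (Fin 1) (a - -e) ∧
        (B_ k).symm x ∈ primePowPiBox (v.adicCompletion F) (Fin 1) (a - -e) ∧
        δ_ k x ∈ primePowPiBox (v.adicCompletion F) (Fin 1) (a - -e) := by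
    intro k hk a x hx
    obtain ⟨h1, h2, h3⟩ := (hkey k (hβk k hk)).2.2.1 x
    rw [h1, h2, h3, sub_neg_eq_add]
    refine ⟨smul_mem_primePowPiBox_of_normAbs_le ?_ hx, smul_mem_primePowPiBox_of_normAbs_le ((hβC k hk).trans he) hx,
      smul_mem_primePowPiBox_of_normAbs_le ((hsC k hk).trans he) hx⟩
    rw [mul_comm]
    exact (hsC k hk).trans he
  -- the Gauss value at every point of the coset
  have hGk : ∀ k ∈ K₀, weilGauss (adeleAddCharAt F v) μ (A k) = weilGauss (adeleAddCharAt F v) μ (A 1) := fun k hk =>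
    (weilGauss_congr_of_sub_mem μ hm hvA ((hAnorm k hk).trans hvA) hv₂ hm₀' (hAmem k hk)).symm
  -- ### assemble: H2 re-centred at `u = z₀ k₁`
  refine ⟨K₀, hK₀o, fun k₁ hk₁ a b ha hb => ?_⟩
  have hbb : b = bOf k₁ := by rw [hb, hbOf k₁]
  have haa : a = aOf k₁ := by rw [ha, haOf k₁]
  subst hbb haa
  refine ⟨by rw [← hβ k₁]; exact hβk k₁ hk₁, fun K hKo hKK₀ W _ hWK hW lam hlam => ?_⟩
  -- the compact torus: `W4` from smoothness
  have hc1 : c ≠ 1 := by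
    rintro rfl
    exact hδ (self_eq_neg.1 (by simpa only [AlgEquiv.one_apply] using hcδ))
  obtain ⟨w⟩ := (inferInstance : Nonempty (PlacesOver E v))
  have hw : c • w.1 = w.1 := by
    by_contra hw
    exact Liu2021.LemD1IndexedNonVacuityAtPlace.not_isField_localRing_of_split E v c w hw hE
  haveI : CompactSpace (localPi E c 1 J₁ v) := compactSpace_localPi_one_of_smul_eq c J₁ hc1 hJ₁' w hw
  have hW4 := exists_finiteIndex_fixing_of_isSmooth ((MpPsi.toRep (localSchrodinger F 1 t v)).comp s₁) hsm₁ K hKo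
  -- the family `k ↦ z₀ (k₁ k)` over `K ≤ K₀`
  have hmem : ∀ k ∈ K, k₁ * k ∈ K₀ := fun k hk => K₀.mul_mem hk₁ (hKK₀ hk)
  have htr := trace_restrict_fixed_eq_of_bigCell_family (isLocallyConstant_of_isContinuousNontrivial hψ) μ hψ hm
    ((MpPsi.toRep (localSchrodinger F 1 t v)).comp s₁) K (z₀ * k₁)
    (fun k => γ_ (k₁ * k)) (fun k => δ_ (k₁ * k)) (fun k => B_ (k₁ * k)) c₀ (weilGauss (adeleAddCharAt F v) μ (A 1)) m₀ (-e)
    (fun k hk f => by rw [mul_assoc]; exact hc₀ (k₁ * k) (hmem k hk) f)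
    (fun k hk n hn => hW2 (k₁ * k) (hmem k hk) n hn)
    (fun k hk a x hx => hW3 (k₁ * k) (hmem k hk) a x hx) hW4 W hWK hW
  rw [htr, hc₀k k₁ hk₁, ← hGk k₁ hk₁]
  -- identify `cst k₁ = lam` and `modSqrt (B_ k₁) = √‖β k₁‖`
  have hkey₁ := hkey k₁ (hβk k₁ hk₁)
  have hcst : cst k₁ = lam := by
    -- both scalars multiply the same word applied to the test vector, non-zero at `0`
    have h1 := hword k₁ hk₁ (piBallSB (v.adicCompletion F) (Fin 1) n₁)
    rw [hlam, ← hkey₁.2.2.2.2.1] at h1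
    have h2 := congrArg (fun f : SchwartzBruhat (Fin 1 → v.adicCompletion F) => (f : (Fin 1 → v.adicCompletion F) → ℂ) 0) h1
    simp only [Submodule.coe_smul, Pi.smul_apply, smul_eq_mul] at h2
    rw [word_piBallSB_apply_zero (isLocallyConstant_of_isContinuousNontrivial hψ) μ hψ hm (γ_ k₁) (δ_ k₁) (B_ k₁) n₁
      (hδφ k₁ hk₁)] at h2
    refine (mul_right_cancel₀ (mul_ne_zero (inv_ne_zero ?_) ?_) h2).symm
    · exact Complex.ofReal_ne_zero.2 (modSqrt_pos _).ne'
    · exact Complex.ofReal_ne_zero.2 (measureReal_piPrimePowBall_pos (Measure.pi fun _ : Fin 1 => μ) n₁).ne'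
  have hmod : modSqrt (B_ k₁) = Real.sqrt (normAbs (v.adicCompletion F) (β k₁)) := by
    rw [modSqrt, hkey₁.2.2.2.2.2]
  rw [hcst, hmod, hA k₁, hβ k₁]

end Explicit

end Literature.RepresentationTheory.MoeglinVignerasWaldspurger1987

end
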